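import Literature.Analysis.Complex.CotangentSummation
import Literature.Analysis.Complex.VerticalLineIBP
import HarnessLib

/-!
# `Σ_{n > c} f''(n)/2` as a line integral of `f` against `π² cos(πz)/sin³(πz)`

Topic `Literature/Analysis/Complex` (contour integration): the combination of the cotangent
summation formula (`CotangentSummation.lean`) with two integrations by parts along the line
(`VerticalLineIBP.lean`). Everything here is PROVED; no definitions, no named facts.

For `f` holomorphic on `{re z > a}` with `‖f z‖ ≤ C/(1 + ‖z‖²)` there:

* `hasSum_iteratedDeriv_two_div_two` — for a non-integer `c > a`,
  `Σ_{n ∈ ℤ, n > c} f''(n)/2 = −(π²/2) ∫ f(c+iy) cos(π(c+iy))/sin³(π(c+iy)) dy`;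
* `hasSum_iteratedDeriv_two_div_two_halfInt` — on a half-integer line `c = m + ½ > a` the kernel
  is `cos/sin³ (π(c+iy)) = −i sinh(πy)/cosh³(πy)` (`cos_div_sin_cube_halfInt`), whence
  `Σ_{n ≥ m+1} f''(n)/2 = (iπ²/2) ∫ f(m + ½ + iy) sinh(πy)/cosh³(πy) dy`.

This is the representation `F = ½ Σ_t R''(t) = (1/2πi) ∫_{M−i∞}^{M+i∞} R(t) π³ cos(πt)/sin³(πt) dt`
of a very-well-poised hypergeometric sum ([Zudilin, Izv. Math. 66 (2002), §4, Lemma 2] with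
`b = 3`, `π³ cot₃ = (π cot π·)''/2`; [Zudilin, J. Théor. Nombres Bordeaux 16 (2004), (8.4)–(8.6)]
with `r = 3`), the starting point of the saddle-point asymptotics of Zudilin's linear forms in
`1, ζ(5), …, ζ(11)`. Folklore.
-/

noncomputable section

open _root_.Complex Set MeasureTheory Filter Real
open scoped _root_.Topology

namespace Literature.Analysis.Complex

/-- **`Σ_{n > c} f''(n)/2 = −(π²/2) ∫ f(c+iy) cos/sin³(π(c+iy)) dy`.** Let `f` be holomorphic on
`{re z > a}` with `‖f z‖ ≤ C/(1+‖z‖²)` there, and `c > a` a real non-integer. Then the series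
`Σ_{n ∈ ℤ, n > c} f''(n)/2` converges (absolutely) to
`−(π²/2) ∫ f(c + iy) cos(π(c+iy))/sin³(π(c+iy)) dy`. [folklore] -/
theorem hasSum_iteratedDeriv_two_div_two {f : ℂ → ℂ} {a c C : ℝ} (hac : a < c)
    (hcZ : ∀ n : ℤ, (n : ℝ) ≠ c)
    (hf : DifferentiableOn ℂ f {z : ℂ | a < z.re})
    (hb : ∀ z : ℂ, a < z.re → ‖f z‖ ≤ C / (1 + ‖z‖ ^ 2)) :
    HasSum (fun k : ℕ ↦ iteratedDeriv 2 f ((⌊c⌋ + 1 + k : ℤ) : ℂ) / 2)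
      (-(π ^ 2 / 2) * ∫ y : ℝ, f (c + y * I) *
        (Complex.cos (π * (c + y * I)) / Complex.sin (π * (c + y * I)) ^ 3)) := by
  -- the half-plane `{re z > a'}`, `a < a' < c`, is an open neighbourhood of `{re z ≥ c}`
  set a' : ℝ := (a + c) / 2 with ha'
  have haa' : a < a' := by rw [ha']; linarith
  have ha'c : a' < c := by rw [ha']; linarith
  have hopen : IsOpen {z : ℂ | a < z.re} := isOpen_lt continuous_const Complex.continuous_re
  have hopen' : IsOpen {z : ℂ | a' < z.re} := isOpen_lt continuous_const Complex.continuous_re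
  -- `h = f''/2` is differentiable there
  have hd2 : DifferentiableOn ℂ (iteratedDeriv 2 f) {z : ℂ | a < z.re} := by
    rw [iteratedDeriv_succ, iteratedDeriv_one]
    exact (hf.deriv hopen).deriv hopen
  have hh : DifferentiableOn ℂ (fun z ↦ iteratedDeriv 2 f z / 2) {z : ℂ | a' < z.re} :=
    (hd2.mono fun z (hz : a' < z.re) ↦ haa'.trans hz).div_const 2
  -- and decays on `{re z ≥ c}`
  set r : ℝ := (c - a) / 2 with hr
  have hr0 : 0 < r := by rw [hr]; linarith
  set C₂ : ℝ := ((2 : ℕ).factorial * (2 * (1 + r ^ 2) * C) / r ^ 2) / 2 with hC₂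
  have hbound : ∀ z : ℂ, c ≤ z.re → ‖iteratedDeriv 2 f z / 2‖ ≤ C₂ / (1 + ‖z‖ ^ 2) := by
    intro z hz
    have hz' : a + r < z.re := by rw [hr]; linarith
    have h := norm_iteratedDeriv_le_of_decay hr0 hf hb 2 hz'
    rw [norm_div, Complex.norm_two, hC₂]
    calc ‖iteratedDeriv 2 f z‖ / 2
        ≤ ((2 : ℕ).factorial * (2 * (1 + r ^ 2) * C) / r ^ 2) / (1 + ‖z‖ ^ 2) / 2 := by gcongr
      _ = _ := by ring
  have hsum := hasSum_int_mul_cot hcZ {z : ℂ | a' < z.re} hopen' (fun z (hz : c ≤ z.re) ↦ by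
    simp only [mem_setOf_eq]; exact ha'c.trans_le hz) hh hbound
  -- rewrite the integral by two integrations by parts
  have hibp := integral_iteratedDeriv_two_mul_cot_line hac hcZ hf hb
  have hint : (∫ y : ℝ, iteratedDeriv 2 f (c + y * I) / 2 * Complex.cos (π * (c + y * I)) /
      Complex.sin (π * (c + y * I))) =
      π ^ 2 * ∫ y : ℝ, f (c + y * I) *
        (Complex.cos (π * (c + y * I)) / Complex.sin (π * (c + y * I)) ^ 3) := by
    have h1 : (∫ y : ℝ, iteratedDeriv 2 f (c + y * I) / 2 * Complex.cos (π * (c + y * I)) /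
        Complex.sin (π * (c + y * I))) = (1 / 2) * ∫ y : ℝ, iteratedDeriv 2 f (c + y * I) *
        (Complex.cos (π * (c + y * I)) / Complex.sin (π * (c + y * I))) := by
      rw [← MeasureTheory.integral_const_mul]
      refine integral_congr_ae (Eventually.of_forall fun y ↦ ?_)
      simp only; ring
    rw [h1, hibp]; ring
  have hval : -(1 / 2 : ℂ) * (∫ y : ℝ, iteratedDeriv 2 f (c + y * I) / 2 *
      Complex.cos (π * (c + y * I)) / Complex.sin (π * (c + y * I))) =
      -(π ^ 2 / 2) * ∫ y : ℝ, f (c + y * I) *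
        (Complex.cos (π * (c + y * I)) / Complex.sin (π * (c + y * I)) ^ 3) := by
    rw [hint]; ring
  rw [← hval]
  simpa only using hsum

/-- On a half-integer line the kernel is real-analytic and odd:
`cos(π(m + ½ + iy)) / sin³(π(m + ½ + iy)) = −i sinh(πy)/cosh³(πy)`. [folklore] -/
theorem cos_div_sin_cube_halfInt (m : ℤ) (y : ℝ) :
    Complex.cos (π * ((m : ℂ) + 1 / 2 + y * I)) / Complex.sin (π * ((m : ℂ) + 1 / 2 + y * I)) ^ 3 =
      -I * (Real.sinh (π * y) : ℂ) / (Real.cosh (π * y) : ℂ) ^ 3 := by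
  set u : ℂ := ((m.negOnePow : ℤ) : ℂ) with hu
  have hu2 : u * u = 1 := by
    rw [hu, ← Int.cast_mul, ← Units.val_mul, Int.units_mul_self, Units.val_one, Int.cast_one]
  have harg : (π : ℂ) * ((m : ℂ) + 1 / 2 + y * I) = ((π * y : ℝ) : ℂ) * I + π / 2 + m * π := by
    push_cast; ring
  have hsin : Complex.sin (π * ((m : ℂ) + 1 / 2 + y * I)) = u * (Real.cosh (π * y) : ℂ) := by
    rw [harg, Complex.sin_antiperiodic.add_int_mul_eq, Complex.sin_add_pi_div_two, Complex.cos_mul_I,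
      Complex.ofReal_cosh]
  have hcos : Complex.cos (π * ((m : ℂ) + 1 / 2 + y * I)) =
      -(u * ((Real.sinh (π * y) : ℂ) * I)) := by
    rw [harg, Complex.cos_antiperiodic.add_int_mul_eq, Complex.cos_add_pi_div_two, Complex.sin_mul_I,
      Complex.ofReal_sinh]; ring
  have hcosh : (Real.cosh (π * y) : ℂ) ≠ 0 := by exact_mod_cast (Real.cosh_pos _).ne'
  have hu0 : u ≠ 0 := fun h0 ↦ by rw [h0, zero_mul] at hu2; exact zero_ne_one hu2
  rw [hsin, hcos, div_eq_div_iff (pow_ne_zero 3 (mul_ne_zero hu0 hcosh)) (pow_ne_zero 3 hcosh)]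
  linear_combination (I * (Real.sinh (π * y) : ℂ) * u * (Real.cosh (π * y) : ℂ) ^ 3) * hu2

/-- **Half-integer line.** Let `f` be holomorphic on `{re z > a}` with `‖f z‖ ≤ C/(1+‖z‖²)`
there and let `m` be an integer with `m + ½ > a`. Then
`Σ_{k ≥ 0} f''(m + 1 + k)/2 = (iπ²/2) ∫ f(m + ½ + iy) sinh(πy)/cosh³(πy) dy`. This is the form of
[Zudilin, Izv. Math. 66 (2002), §4 Lemma 2] (`b = 3`) used with the line through a half-integer
inside a block of triple zeros of `R`. [folklore] -/
theorem hasSum_iteratedDeriv_two_div_two_halfInt {f : ℂ → ℂ} {a C : ℝ} {m : ℤ}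
    (ham : a < m + 1 / 2)
    (hf : DifferentiableOn ℂ f {z : ℂ | a < z.re})
    (hb : ∀ z : ℂ, a < z.re → ‖f z‖ ≤ C / (1 + ‖z‖ ^ 2)) :
    HasSum (fun k : ℕ ↦ iteratedDeriv 2 f ((m + 1 + k : ℤ) : ℂ) / 2)
      ((I * π ^ 2 / 2) * ∫ y : ℝ, f ((m : ℂ) + 1 / 2 + y * I) *
        ((Real.sinh (π * y) : ℂ) / (Real.cosh (π * y) : ℂ) ^ 3)) := by
  have hcZ : ∀ n : ℤ, (n : ℝ) ≠ (m : ℝ) + 1 / 2 := by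
    intro n hn
    have h2 : (2 * (n - m) : ℤ) = 1 := by exact_mod_cast (show (2 * (n - m) : ℝ) = 1 by linarith)
    omega
  have hfl : ⌊(m : ℝ) + 1 / 2⌋ = m := by
    rw [Int.floor_eq_iff]; constructor <;> linarith
  have h := hasSum_iteratedDeriv_two_div_two ham hcZ hf hb
  rw [hfl] at h
  have hcast : (((m : ℝ) + 1 / 2 : ℝ) : ℂ) = (m : ℂ) + 1 / 2 := by push_cast; ring
  simp_rw [hcast] at h
  convert h using 1
  rw [show I * (π : ℂ) ^ 2 / 2 = -(π ^ 2 / 2) * (-I) by ring, mul_assoc,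
    ← MeasureTheory.integral_const_mul (-I)]
  congr 1
  refine integral_congr_ae (Eventually.of_forall fun y ↦ ?_)
  simp only
  rw [cos_div_sin_cube_halfInt]
  ring

end Literature.Analysis.Complex
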